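import Mathlib
import Summits.Ventures.PercRepro2.K5HyperI
import Summits.Ventures.PercRepro2.K5K3Kernel

/-!
# THE (ii)- AND (i)-SIDE STAR COMPARISONS ON `K₅` AT THE COINCIDENCE MARKINGS: THE KRONECKER NUMBERS
(blind cell PercRepro2, typer-1 g12; mine-1 §23.1 / §23.5 at the three `MarksDistinct` markings of `K₅` —
`b = 4` (g10's `K5Hyper.lean` / `K5HyperI.lean`), `b = 3` (the coincidence `b = a₃`), `b = 0` (the coincidence
`o = b`); the same recipe as g11's `K5HyperK3CmpB.lean` for the crux kernel)

The six tables of `K5Kernel.lean` that mention `b` are re-declared with the marking as a parameter through the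
cluster tables `tL v = 1_{v ∈ C₁}`, `tH v = 1_{v ∈ C₂}` of `K5K3Kernel.lean`: `tQBb b = Q ∧ H_b`, `tABb b = A ∧ H_b`,
`tABOb b = A ∧ H_b ∧ H_o` ((ii) side) and `tQBLb b = Q ∧ L_b`, `tABLb b = A ∧ L_b`, `tABOLb b = A ∧ L_b ∧ H_o`
((i) side); at `b = 4` they are the tables of `K5Kernel.lean` definitionally (`tQBb_four`, …).  The products
`posOnB b` / `negOnB b` (the cleared (ii) at the marking `b`, count `pos − neg`) and `posOnIB b` / `negOnIB b`
(the cleared (i), count `neg − pos`) then give the two sides of every comparison through the generic placement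
sums of `K5HyperI.lean`: `kPosMB b D P` / `kNegMB b D P` (`M(H, T, e) ≥ 0`), `kPosTvTB b x y z` / `kNegTvTB b x y z`
(`TvT-(ii) ≥ 0`) and their (i) forms `kPosMIB` / `kNegMIB`, `kPosTvTIB` / `kNegTvTIB`; the hyperedge base terms are
`sumT1 (posOnB b) D`, … as in `K5HyperCertT1.lean`.  At `b = 4` everything is g10's (`kPosMB_four`, …).  Base
`KB3 = 2^23` (at most `60` products per side, digits `≤ 60 · 3^10 < 2^22`).  Certificates:
`K5HyperCertB{3,0}M*.lean`, `K5HyperCertB{3,0}TvT*.lean`, `K5HyperCertB{3,0}T*.lean` and the (i) files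
`K5HyperCertIB{3,0}*.lean`, one `decide +kernel` each under `maxHeartbeats 0`.  Python twin
`k5hyper_b_twin.py <side> <b>` (kit job j246854: b = 4 as the regression control against the twins of record).
-/

namespace Summit.Ventures.PercRepro2

namespace K5

/-! ## The tables that mention `b`, with the marking as a parameter -/

/-- `Q ∩ {b ∈ C₂}` at the marking `b`. -/
def tQBb (b : ℕ) (ω : Fin 10 → Bool) : Bool := tQ ω && tH b ω

/-- `A ∩ {b ∈ C₂}` at the marking `b`. -/
def tABb (b : ℕ) (ω : Fin 10 → Bool) : Bool := tA ω && tH b ω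

/-- `A ∩ {b ∈ C₂} ∩ {o ∈ C₂}` at the marking `b`. -/
def tABOb (b : ℕ) (ω : Fin 10 → Bool) : Bool := tA ω && tH b ω && tH 0 ω

/-- `Q ∩ {b ∈ C₁}` at the marking `b` (the (i) side). -/
def tQBLb (b : ℕ) (ω : Fin 10 → Bool) : Bool := tQ ω && tL b ω

/-- `A ∩ {b ∈ C₁}` at the marking `b`. -/
def tABLb (b : ℕ) (ω : Fin 10 → Bool) : Bool := tA ω && tL b ω

/-- `A ∩ {b ∈ C₁} ∩ {o ∈ C₂}` at the marking `b`. -/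
def tABOLb (b : ℕ) (ω : Fin 10 → Bool) : Bool := tA ω && tL b ω && tH 0 ω

/-- At the distinct marking, `K5Kernel.lean`'s table. -/
theorem tQBb_four : tQBb 4 = tQB := rfl

/-- At the distinct marking, `K5Kernel.lean`'s table. -/
theorem tABb_four : tABb 4 = tAB := rfl

/-- At the distinct marking, `K5Kernel.lean`'s table. -/
theorem tABOb_four : tABOb 4 = tABO := rfl

/-- At the distinct marking, `K5Kernel.lean`'s table. -/
theorem tQBLb_four : tQBLb 4 = tQBL := rfl

/-- At the distinct marking, `K5Kernel.lean`'s table. -/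
theorem tABLb_four : tABLb 4 = tABL := rfl

/-- At the distinct marking, `K5Kernel.lean`'s table. -/
theorem tABOLb_four : tABOLb 4 = tABOL := rfl

/-! ## The cleared (ii) and (i) on a three-copy pattern, at the marking `b` -/

/-- The positive products of the cleared (ii) at the marking `b` on the pattern `(S₁, S₂, S₃)`:
`kron ABO_b · kron Q · kron PD + kron QB_b · kron PDoU · kron A`. -/
def posOnB (b : ℕ) (S₁ S₂ S₃ : Fin 10 → Bool) : ℕ :=
  kron3 (tABOb b) S₁ * kron3 tQ S₂ * kron3 tPD S₃ + kron3 (tQBb b) S₁ * kron3 tPDoU S₂ * kron3 tA S₃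

/-- The negative products of the cleared (ii) at the marking `b`:
`kron QB_b · kron AO · kron PD + kron AB_b · kron PDoU · kron Q`. -/
def negOnB (b : ℕ) (S₁ S₂ S₃ : Fin 10 → Bool) : ℕ :=
  kron3 (tQBb b) S₁ * kron3 tAO S₂ * kron3 tPD S₃ + kron3 (tABb b) S₁ * kron3 tPDoU S₂ * kron3 tQ S₃

/-- The positive products of the cleared (i) at the marking `b`:
`kron ABOL_b · kron Q · kron PD + kron QBL_b · kron PDoU · kron A`. -/
def posOnIB (b : ℕ) (S₁ S₂ S₃ : Fin 10 → Bool) : ℕ :=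
  kron3 (tABOLb b) S₁ * kron3 tQ S₂ * kron3 tPD S₃ + kron3 (tQBLb b) S₁ * kron3 tPDoU S₂ * kron3 tA S₃

/-- The negative products of the cleared (i) at the marking `b`:
`kron QBL_b · kron AO · kron PD + kron ABL_b · kron PDoU · kron Q`. -/
def negOnIB (b : ℕ) (S₁ S₂ S₃ : Fin 10 → Bool) : ℕ :=
  kron3 (tQBLb b) S₁ * kron3 tAO S₂ * kron3 tPD S₃ + kron3 (tABLb b) S₁ * kron3 tPDoU S₂ * kron3 tQ S₃

/-- At the distinct marking these are g10's `posOn`. -/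
theorem posOnB_four : posOnB 4 = posOn := rfl

/-- At the distinct marking these are g10's `negOn`. -/
theorem negOnB_four : negOnB 4 = negOn := rfl

/-- At the distinct marking these are g10's `posOnI`. -/
theorem posOnIB_four : posOnIB 4 = posOnI := rfl

/-- At the distinct marking these are g10's `negOnI`. -/
theorem negOnIB_four : negOnIB 4 = negOnI := rfl

/-! ## The comparisons as Kronecker numbers -/

/-- **`M(H, T, e) ≥ 0` at the marking `b`** ((ii) side, count `pos − neg`):
`kPosMB b D P = N(H+T(1)+e(1))⁺ + N(H+T(1))⁻`. -/
def kPosMB (b : ℕ) (D P : Fin 10 → Bool) : ℕ := sumT1e1 (posOnB b) D P + sumT1 (negOnB b) D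

/-- The other side of `M(H, T, e)` at the marking `b`. -/
def kNegMB (b : ℕ) (D P : Fin 10 → Bool) : ℕ := sumT1e1 (negOnB b) D P + sumT1 (posOnB b) D

/-- **`TvT-(ii) ≥ 0` at the marking `b`** on the triangle `{x, y, z}`:
`kPosTvTB b x y z = N(H+△(1,1,1))⁺ + N(H+T(1))⁻`. -/
def kPosTvTB (b x y z : ℕ) : ℕ :=
  sumE3 (posOnB b) (pairMask x y) (pairMask x z) (pairMask y z) + sumT1 (negOnB b) (triMask x y z)

/-- The other side of `TvT-(ii)` at the marking `b`. -/
def kNegTvTB (b x y z : ℕ) : ℕ :=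
  sumE3 (negOnB b) (pairMask x y) (pairMask x z) (pairMask y z) + sumT1 (posOnB b) (triMask x y z)

/-- **`M-(i) ≥ 0` at the marking `b`** (the (i) count being `neg − pos`):
`kPosMIB b D P = N⁽ⁱ⁾(H+T(1)+e(1))⁻ + N⁽ⁱ⁾(H+T(1))⁺`. -/
def kPosMIB (b : ℕ) (D P : Fin 10 → Bool) : ℕ := sumT1e1 (negOnIB b) D P + sumT1 (posOnIB b) D

/-- The other side of `M-(i)` at the marking `b`. -/
def kNegMIB (b : ℕ) (D P : Fin 10 → Bool) : ℕ := sumT1e1 (posOnIB b) D P + sumT1 (negOnIB b) D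

/-- **`TvT-(i) ≥ 0` at the marking `b`**: `kPosTvTIB b x y z = N⁽ⁱ⁾(H+△(1,1,1))⁻ + N⁽ⁱ⁾(H+T(1))⁺`. -/
def kPosTvTIB (b x y z : ℕ) : ℕ :=
  sumE3 (negOnIB b) (pairMask x y) (pairMask x z) (pairMask y z) + sumT1 (posOnIB b) (triMask x y z)

/-- The other side of `TvT-(i)` at the marking `b`. -/
def kNegTvTIB (b x y z : ℕ) : ℕ :=
  sumE3 (posOnIB b) (pairMask x y) (pairMask x z) (pairMask y z) + sumT1 (negOnIB b) (triMask x y z)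

/-- At the distinct marking these are g10's `kPosM`. -/
theorem kPosMB_four : kPosMB 4 = kPosM := by
  funext D P
  simp only [kPosMB, kPosM, sumT1e1, sumT1, posT1e1, negT1, posOnB_four, negOnB_four]

/-- At the distinct marking these are g10's `kNegM`. -/
theorem kNegMB_four : kNegMB 4 = kNegM := by
  funext D P
  simp only [kNegMB, kNegM, sumT1e1, sumT1, negT1e1, posT1, posOnB_four, negOnB_four]

/-- At the distinct marking these are g10's `kPosTvT`. -/
theorem kPosTvTB_four : kPosTvTB 4 = kPosTvT := by
  funext x y z
  simp only [kPosTvTB, kPosTvT, sumE3, sumE3a, sumE3b, sumE3c, sumT1, posE3, posE3a, posE3b, posE3c,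
    negT1, posOnB_four, negOnB_four]

/-- At the distinct marking these are g10's `kNegTvT`. -/
theorem kNegTvTB_four : kNegTvTB 4 = kNegTvT := by
  funext x y z
  simp only [kNegTvTB, kNegTvT, sumE3, sumE3a, sumE3b, sumE3c, sumT1, negE3, negE3a, negE3b, negE3c,
    posT1, posOnB_four, negOnB_four]

/-- At the distinct marking these are g10's `kPosMI`. -/
theorem kPosMIB_four : kPosMIB 4 = kPosMI := rfl

/-- At the distinct marking these are g10's `kNegMI`. -/
theorem kNegMIB_four : kNegMIB 4 = kNegMI := rfl

/-- At the distinct marking these are g10's `kPosTvTI`. -/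
theorem kPosTvTIB_four : kPosTvTIB 4 = kPosTvTI := rfl

/-- At the distinct marking these are g10's `kNegTvTI`. -/
theorem kNegTvTIB_four : kNegTvTIB 4 = kNegTvTI := rfl

end K5

end Summit.Ventures.PercRepro2
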